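import Literature.Computability.Learning.IWPadGeneratorValue
import Literature.Computability.Complexity.UniformDerandomizationNonuniform
import Literature.Computability.Complexity.IoAvgHardMachine
import Literature.Computability.Complexity.UniformDerandomizationProofs
import HarnessLib

/-!
# The IW generator on the pad fools uniform tests where the hard language is hard on average
# (Impagliazzo–Wigderson 1998, case `EXP ⊄ P/poly`)

Consumer of `IWPadGeneratorValue.lean` (the generator `IWGen.iwGen k e c₀` IS the Nisan–Wigderson
generator on the explicit design `designOf k ℓ`, hard function `f_ℓ = [· ∈ H]`, seed `σ ↾ q²`) and of
`Complexity/UniformDerandomizationNonuniform.lean` (a uniform probabilistic test against an NW generator is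
an average of polynomial-size circuits, each beaten by Nisan–Wigderson's lemma). Together they settle the
case `EXP ⊄ P/poly` of the hinge of `Complexity/UniformDerandomizationProofs.lean`
(`impagliazzoWigderson1998_samplable_of_uniformPRG`) down to its classical input, an `EXP`-language that
is infinitely often hard on average for every polynomial circuit size (Babai–Fortnow–Nisan–Wigderson 1993,
as invoked by Impagliazzo–Wigderson, §2.1: "since [BFNW] show that `BPP ⊆ i.o.-SUBEXP` assuming
`EXP ⊄ P/poly`, we can assume `EXP ⊂ P/poly`"):

* `IWGen.vOf_injective`, **`isNWDesign_designOf`** — the `ℓ^k` blocks `S_{v_j}` form an NW design with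
  intersections `≤ ℓ' = k(⌊log₂ ℓ⌋ + 1)` (distinct indices `j < ℓ^k ≤ 2^{ℓ'}` have distinct codes);
* `eventually_univBound_lp_le` — the table size `univBound ℓ' ≤ 5 · 2^{ℓ'} ≤ 5 (2ℓ)^k`
  (`RazMonomialCkt.univBound_le`) is polynomial; `eventually_prmQ_sq_le` — the seed prefix `q² ≤ 4ℓ² ≤ ℓ^{c₀}` (`c₀ ≥ 3`);
* **`iwGen_fools_of_ioAvgHard`** — for `H ∈ DTIME(2^{n^b})`, `c₀ > b`, `c₀ ≥ 3`: if
  `∀ c, ∃^∞ n, H_avg([· ∈ H]↾{0,1}ⁿ) ≥ n^c` then `iwGen k e c₀` fools every PPT test infinitely often at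
  every rate `1/ℓ^c`;
* **`uniformPRG_of_ioAvgHard`** — hence the full hinge (`∃ c₀ ∀ k ∃ G`, pad-computable, fooling) from the
  existence of such an `H` in `EXP`, and **`uniformPRG_of_not_EXP_subset_PPoly`** — the case
  `EXP ⊄ P/poly` of Impagliazzo–Wigderson's Thm. 5 outright, through the tree's BFNW chain
  (`IoHard.exists_ioAvgHard_of_not_EXP_subset_PPoly`);
* **`impagliazzoWigderson1998_samplable_of_caseB`** (and `impagliazzoWigderson1998_of_caseB`) — the
  discharge of the named fact reduced, by the case split, to the hinge in the case `EXP ⊆ P/poly` alone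
  (Impagliazzo–Wigderson §2.2–2.4 / Trevisan–Vadhan Thm. 3.9, Lemmas 3.5–3.8), an explicit hypothesis.

Everything is proved; no definitions, no named facts.

## References

* [ImpagliazzoWigderson2001] R. Impagliazzo, A. Wigderson, *Randomness vs time: derandomization under a
  uniform assumption*, JCSS 63 (2001) 672–688, Thm. 5 and §2.1.
* L. Babai, L. Fortnow, N. Nisan, A. Wigderson, Comput. Complexity 3 (1993) 307–318, §4 (not held; cited
  through IW §2.1 and van Melkebeek Thm. 2.3.7).
* [NisanWigderson1994] N. Nisan, A. Wigderson, JCSS 49 (1994), Lemmas 2.4–2.5.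
* [TrevisanVadhan2007] L. Trevisan, S. Vadhan, Comput. Complexity 16 (2007), Thm. 3.9 (the generator `G₁`).
* [VanMelkebeek2000] D. van Melkebeek, LNCS 1950 (2000), Thm. 6.2.1 (p. 142), Thm. 2.3.7 (p. 37).
* [AroraBarakCC2009] S. Arora, B. Barak, CUP 2009, Lemma 20.15, Thm. 7.14.
-/

noncomputable section

open Polynomial Filter

namespace Literature.Computability.Learning

open Literature.Computability.Complexity Literature.Computability.Complexity.UDerand
  Literature.Computability.MetaComplexity _root_.Computability

namespace IWGen

variable (k : ℕ)

/-! ### The design property of the blocks `S_{v_j}` -/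

/-- Distinct output positions `j < ℓ^k` have distinct block indices `v_j` (`ℓ^k ≤ 2^{ℓ'}` and the
`ℓ'`-bit numerals are injective below `2^{ℓ'}`). [folklore] -/
theorem vOf_injective (ℓ : ℕ) : Function.Injective fun j : Fin (ℓ ^ k) => vOf k ℓ j := by
  intro j₁ j₂ h
  have h₁ : (j₁ : ℕ) < 2 ^ lp k ℓ := lt_of_lt_of_le j₁.isLt (pow_le_two_pow_lp k ℓ)
  have h₂ : (j₂ : ℕ) < 2 ^ lp k ℓ := lt_of_lt_of_le j₂.isLt (pow_le_two_pow_lp k ℓ)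
  have hv : vbitsOf (lp k ℓ) j₁ = vbitsOf (lp k ℓ) j₂ := by
    rw [← ofFn_vOf, ← ofFn_vOf]
    exact congrArg List.ofFn h
  rw [vbitsOf, vbitsOf, PRGDerand.takeD_encodeNat_eq_natBits h₁, PRGDerand.takeD_encodeNat_eq_natBits h₂] at hv
  apply Fin.ext
  rw [← bitsToNat_natBits h₁, hv, bitsToNat_natBits h₂]

/-- **The blocks form an NW design** with intersections `≤ ℓ'`. [cite: NisanWigderson1994, Lemma 2.5] -/
theorem isNWDesign_designOf (ℓ : ℕ) : IsNWDesign (lp k ℓ) (designOf k ℓ) :=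
  (isNWDesign_cikkDesign (prmQ ℓ) ℓ (lp k ℓ) (prmQ_spec ℓ).1).comp_injective (vOf_injective k ℓ)

/-! ### Sizes: the table bound and the seed prefix are polynomial -/

/-! `univBound m ≤ 5 · 2^m` is `RazMonomialCkt.univBound_le` (`AlgebraicComplexity/RazMonomialCircuits.lean`). -/

/-- `2^{ℓ'} ≤ (2ℓ)^k` for `ℓ ≥ 1`. [folklore] -/
theorem two_pow_lp_le (ℓ : ℕ) (hℓ : 1 ≤ ℓ) : 2 ^ lp k ℓ ≤ (2 * ℓ) ^ k := by
  rw [lp, mul_comm, pow_mul]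
  refine Nat.pow_le_pow_left ?_ k
  rw [pow_succ, mul_comm]
  exact Nat.mul_le_mul_left 2 (Nat.pow_log_le_self 2 (by omega))

/-- **The table size is polynomial**: `univBound ℓ' ≤ 5 · 2^k · ℓ^k` eventually. [folklore] -/
theorem eventually_univBound_lp_le :
    ∀ᶠ ℓ in atTop, univBound (lp k ℓ) ≤ (C (5 * 2 ^ k) * X ^ k : Polynomial ℕ).eval ℓ := by
  filter_upwards [eventually_ge_atTop 1] with ℓ hℓ
  rw [eval_mul, eval_C, eval_pow, eval_X]
  have h2 := two_pow_lp_le k ℓ hℓ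
  rw [mul_pow] at h2
  have h3 : 5 * 2 ^ lp k ℓ ≤ 5 * (2 ^ k * ℓ ^ k) := Nat.mul_le_mul_left 5 h2
  calc univBound (lp k ℓ) ≤ 5 * 2 ^ lp k ℓ := Literature.Computability.AlgebraicComplexity.RazMonomialCkt.univBound_le _
    _ ≤ 5 * 2 ^ k * ℓ ^ k := by rw [mul_assoc]; exact h3

/-- **The seed prefix fits**: `q² ≤ ℓ^{c₀}` eventually (`q ≤ 2ℓ`, `c₀ ≥ 3`). [folklore] -/
theorem eventually_prmQ_sq_le (c₀ : ℕ) (h3 : 3 ≤ c₀) : ∀ᶠ ℓ in atTop, prmQ ℓ * prmQ ℓ ≤ ℓ ^ c₀ := by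
  filter_upwards [eventually_ge_atTop 4] with ℓ hℓ
  have hq := prmQ_le ℓ (by omega)
  calc prmQ ℓ * prmQ ℓ ≤ (2 * ℓ) * (2 * ℓ) := Nat.mul_le_mul hq hq
    _ = 4 * ℓ ^ 2 := by ring
    _ ≤ ℓ * ℓ ^ 2 := Nat.mul_le_mul_right _ hℓ
    _ = ℓ ^ 3 := by ring
    _ ≤ ℓ ^ c₀ := Nat.pow_le_pow_right (by omega) h3

/-- The seed read by the generator is the prefix of `UniformDerandomizationNonuniform.pref`. [folklore] -/
theorem zOf_toList_eq_pref (ℓ c₀ : ℕ) (ha : prmQ ℓ * prmQ ℓ ≤ ℓ ^ c₀) (σ : List.Vector Bool (ℓ ^ c₀))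
    (hσ : prmQ ℓ * prmQ ℓ ≤ σ.toList.length) :
    zOf ℓ σ.toList hσ = pref (prmQ ℓ * prmQ ℓ) ha σ := by
  funext p
  simp [zOf, pref, List.Vector.get_eq_get_toList]

/-! ### Fooling uniform tests at the hard lengths -/

/-- **The IW generator fools every PPT test infinitely often at every rate, given i.o. average-case
hardness of `H` for all polynomial sizes** (`H ∈ DTIME(2^{n^b})`, `b < c₀`, `3 ≤ c₀`).
[cite: ImpagliazzoWigderson2001, §2.1] [cite: NisanWigderson1994, Lemma 2.4] [cite: AroraBarakCC2009, Lemma 20.15] -/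
theorem iwGen_fools_of_ioAvgHard {H : Language Bool} {b c₀ : ℕ} (hH : H ∈ DTIME (fun n => 2 ^ n ^ b))
    (hc₀ : b < c₀) (h3 : 3 ≤ c₀)
    (hhard : ∀ c : ℕ, ∃ᶠ n in atTop, AvgHardAtLeast (H.sliceFn n) ((n : ℝ) ^ c)) :
    ∃ e : List Bool, ∀ T : RandAlg (List Bool) Bool, T.IsPolyTime id encodeBool → ∀ c : ℕ,
      ∃ᶠ ℓ in atTop, |seedAvg c₀ k (iwGen k e c₀) T ℓ - unifAvg k T ℓ| < 1 / (ℓ : ℝ) ^ c := by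
  obtain ⟨e, he⟩ := eventually_iwGen_eq_ofFn_nwGenerator k hH hc₀
  refine ⟨e, fun T hT c => ?_⟩
  refine frequently_abs_seedAvg_sub_unifAvg_lt (c₀ := c₀) (k := k) (G := iwGen k e c₀) (n := fun ℓ => ℓ)
    (a := fun ℓ => prmQ ℓ * prmQ ℓ) (d := fun ℓ => lp k ℓ) (designOf k) (fun ℓ => H.sliceFn ℓ)
    (Eventually.of_forall (isNWDesign_designOf k)) ?_ ⟨_, eventually_univBound_lp_le k⟩ hhard hT c
  filter_upwards [he, eventually_prmQ_sq_le c₀ h3] with ℓ heℓ ha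
  refine ⟨ha, fun σ => ?_⟩
  have hσ : prmQ ℓ * prmQ ℓ ≤ σ.toList.length := by rwa [List.Vector.toList_length]
  rw [heℓ σ.toList hσ, zOf_toList_eq_pref ℓ c₀ ha σ hσ]

/-- **Case `EXP ⊄ P/poly` of the hinge, from an i.o. average-case hard language in `EXP`.** If some
`H ∈ DTIME(2^{n^b})` is infinitely often hard on average for every polynomial size
(`∀ c, ∃^∞ n, H_avg(H↾{0,1}ⁿ) ≥ n^c` — Babai–Fortnow–Nisan–Wigderson's conclusion from `EXP ⊄ P/poly`),
then the hypothesis of `impagliazzoWigderson1998_samplable_of_uniformPRG` holds outright (with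
`c₀ = b + 3` and `G = iwGen k e c₀`): generators on `ℓ^{c₀}` seed bits, computable in `FP` on the pad
`1^{2^{ℓ^{c₀}}}`, fooling every PPT test infinitely often at every rate.
[cite: ImpagliazzoWigderson2001, Thm. 5 and §2.1] [cite: VanMelkebeek2000, Thm. 6.2.1 and Thm. 2.3.7]
[cite: TrevisanVadhan2007, Thm. 3.9] -/
theorem uniformPRG_of_ioAvgHard
    (hA : ∃ (H : Language Bool) (b : ℕ), H ∈ DTIME (fun n => 2 ^ n ^ b) ∧
      ∀ c : ℕ, ∃ᶠ n in atTop, AvgHardAtLeast (H.sliceFn n) ((n : ℝ) ^ c)) :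
    ∃ c₀ : ℕ, ∀ k : ℕ, ∃ G : ℕ → List Bool → List Bool,
      (∃ F ∈ FP, ∀ (ℓ : ℕ) (σ : List Bool), σ.length = ℓ ^ c₀ →
          F (ones (2 ^ ℓ ^ c₀) ++ false :: boolPair (ones ℓ) σ) = G ℓ σ) ∧
      ∀ T : RandAlg (List Bool) Bool, T.IsPolyTime id encodeBool →
        (∃ q : Polynomial ℕ, ∀ N, T.coinLen N = q.eval N) → ∀ c : ℕ,
          ∃ᶠ ℓ : ℕ in atTop, |seedAvg c₀ k G T ℓ - unifAvg k T ℓ| < 1 / (ℓ : ℝ) ^ c := by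
  obtain ⟨H, b, hH, hhard⟩ := hA
  refine ⟨b + 3, fun k => ?_⟩
  obtain ⟨e, he⟩ := iwGen_fools_of_ioAvgHard k (c₀ := b + 3) hH (by omega) (by omega) hhard
  exact ⟨iwGen k e (b + 3), iwGen_pad k e (b + 3), fun T hT _ c => he T hT c⟩

/-- **Case `EXP ⊄ P/poly` of the hinge, unconditionally in that case.** Combining
`uniformPRG_of_ioAvgHard` with the tree's Babai–Fortnow–Nisan–Wigderson chain
(`IoHard.exists_ioAvgHard_of_not_EXP_subset_PPoly`: worst-case `EXP ⊄ P/poly` ⟹ an `EXP`-language i.o.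
average-case hard for every polynomial size, `Complexity/IoAvgHardLanguage.lean` +
`IoAvgHardMachine.lean`): if `EXP ⊄ P/poly` then the hypothesis of
`impagliazzoWigderson1998_samplable_of_uniformPRG` holds. What remains of the discharge of
`impagliazzoWigderson1998_samplable` is the case `EXP ⊆ P/poly` (Impagliazzo–Wigderson's uniform
reconstruction, §2.2–2.4 / Trevisan–Vadhan Thm. 3.9 with a downward-self-reducible complete problem).
[cite: ImpagliazzoWigderson2001, Thm. 5 and §2.1] [cite: VanMelkebeek2000, Thm. 6.2.1 and Thm. 2.3.7] -/
theorem uniformPRG_of_not_EXP_subset_PPoly (h : ¬ EXP ⊆ PPoly) :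
    ∃ c₀ : ℕ, ∀ k : ℕ, ∃ G : ℕ → List Bool → List Bool,
      (∃ F ∈ FP, ∀ (ℓ : ℕ) (σ : List Bool), σ.length = ℓ ^ c₀ →
          F (ones (2 ^ ℓ ^ c₀) ++ false :: boolPair (ones ℓ) σ) = G ℓ σ) ∧
      ∀ T : RandAlg (List Bool) Bool, T.IsPolyTime id encodeBool →
        (∃ q : Polynomial ℕ, ∀ N, T.coinLen N = q.eval N) → ∀ c : ℕ,
          ∃ᶠ ℓ : ℕ in atTop, |seedAvg c₀ k G T ℓ - unifAvg k T ℓ| < 1 / (ℓ : ℝ) ^ c :=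
  uniformPRG_of_ioAvgHard (IoHard.exists_ioAvgHard_of_not_EXP_subset_PPoly h)

/-- **The discharge of `impagliazzoWigderson1998_samplable` reduced to the case `EXP ⊆ P/poly`.** With
Case `EXP ⊄ P/poly` settled (`uniformPRG_of_not_EXP_subset_PPoly`), van Melkebeek's Thm. 6.2.1 follows
from the hinge in the remaining case alone — Impagliazzo–Wigderson's uniform reconstruction under
`EXP ⊆ P/poly` and `BPP ≠ EXP` (§2.2–2.4: the NW/XOR generator of a downward- and random-self-reducible
`EXP`-complete function, learned from any uniform distinguisher; Trevisan–Vadhan Thm. 3.9 with Lemmas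
3.5–3.8), stated here as the explicit hypothesis `hB` in the hinge's own form (not a named fact).
[cite: VanMelkebeek2000, Thm. 6.2.1] [cite: ImpagliazzoWigderson2001, Thm. 5 and §2.1–2.4]
[cite: TrevisanVadhan2007, Thm. 3.9] -/
theorem impagliazzoWigderson1998_samplable_of_caseB
    (hB : EXP ⊆ PPoly → BPP ≠ EXP → ∃ c₀ : ℕ, ∀ k : ℕ, ∃ G : ℕ → List Bool → List Bool,
      (∃ F ∈ FP, ∀ (ℓ : ℕ) (σ : List Bool), σ.length = ℓ ^ c₀ →
          F (ones (2 ^ ℓ ^ c₀) ++ false :: boolPair (ones ℓ) σ) = G ℓ σ) ∧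
      ∀ T : RandAlg (List Bool) Bool, T.IsPolyTime id encodeBool →
        (∃ q : Polynomial ℕ, ∀ N, T.coinLen N = q.eval N) → ∀ c : ℕ,
          ∃ᶠ ℓ : ℕ in atTop, |seedAvg c₀ k G T ℓ - unifAvg k T ℓ| < 1 / (ℓ : ℝ) ^ c) :
    impagliazzoWigderson1998_samplable :=
  impagliazzoWigderson1998_samplable_of_uniformPRG fun hne => by
    by_cases h : EXP ⊆ PPoly
    · exact hB h hne
    · exact uniformPRG_of_not_EXP_subset_PPoly h

/-- The same reduction for the printed-class rendering `impagliazzoWigderson1998`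
(`UniformDerandomizationRandAlg.lean`). [cite: VanMelkebeek2000, Thm. 6.2.1]
[cite: ImpagliazzoWigderson2001, Thm. 5] -/
theorem impagliazzoWigderson1998_of_caseB
    (hB : EXP ⊆ PPoly → BPP ≠ EXP → ∃ c₀ : ℕ, ∀ k : ℕ, ∃ G : ℕ → List Bool → List Bool,
      (∃ F ∈ FP, ∀ (ℓ : ℕ) (σ : List Bool), σ.length = ℓ ^ c₀ →
          F (ones (2 ^ ℓ ^ c₀) ++ false :: boolPair (ones ℓ) σ) = G ℓ σ) ∧
      ∀ T : RandAlg (List Bool) Bool, T.IsPolyTime id encodeBool →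
        (∃ q : Polynomial ℕ, ∀ N, T.coinLen N = q.eval N) → ∀ c : ℕ,
          ∃ᶠ ℓ : ℕ in atTop, |seedAvg c₀ k G T ℓ - unifAvg k T ℓ| < 1 / (ℓ : ℝ) ^ c) :
    impagliazzoWigderson1998 :=
  impagliazzoWigderson1998_of_uniformPRG fun hne => by
    by_cases h : EXP ⊆ PPoly
    · exact hB h hne
    · exact uniformPRG_of_not_EXP_subset_PPoly h

end IWGen

end Literature.Computability.Learning

end
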